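import Summits.AtomisticToContinuum.FouriersLaw.Theses.CoercivePulse
import Summits.AtomisticToContinuum.FouriersLaw.Theses.CageBudgetFekete
import Summits.AtomisticToContinuum.FouriersLaw.Theorems.CoercivePulseLinearCeilingIffAbelCeiling
import Summits.AtomisticToContinuum.FouriersLaw.Theorems.CageBudgetFeketeHeatVarianceCalculus
import HarnessLib

/-!
# `CoercivePulse.LinearCeiling` ⇔ `CageBudgetFekete.HeatVarianceCeiling` (items stmt-15383 ⇔ stmt-15770)

Line `SpikeLemma` of crux `CoercivePulse.LinearCeiling` (item stmt-AtomisticToContinuum-15383), lead c1, 2026-08-17.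
Machine-checked DE-DUPLICATION of two open cruxes of two routes of `FouriersLaw`:

* `CoercivePulse.LinearCeiling` (stmt-15383): anchored at-most-linear envelope of the Helfand moment
  `M(t) = Σ_x x² S(x,t)` of the averaged equilibrium energy pulse, for every guarded pair `(μ, D)`;
* `CageBudgetFekete.HeatVarianceCeiling` (stmt-15770): `V_T(τ) = 2∫_{(0,τ]}(τ − s)C_T(s)ds ≤ B·τ` eventually, for every
  guarded pair (the equilibrium heat variance grows at most linearly).

Both are the infinite-volume Abel ceiling (AC) of `C_T` (`linearCeiling_iff_abelCeiling`, landed):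
`HeatVarianceCeiling ⇒ (AC)` by the PROVED `HeatVarianceCalculus` (stmt-15772: Laplace identity
`∫₀^∞e^{−νt}C_T = (ν²/2)∫₀^∞e^{−νt}V_T`) and the small-time bound `|V_T(t)| ≤ 2σ(ℝ)t²` (cosine Bochner);
`(AC) ⇒ HeatVarianceCeiling` with `τ₁ = 0` is the kernel comparison `stub_envelopeOfSpectralAbelBound` of the line.
So whichever of the two items closes (or is refuted), the other follows by these certificates.

[cite: Helfand1960, §II] [cite: BonettoLebowitzReyBellet2000, §7 eq. (37)] [cite: Widder1941, Ch. V §1]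
-/

noncomputable section

namespace Summit.AtomisticToContinuum.FouriersLaw.Theorems.LinearCeiling.SpikeLemma

open MeasureTheory Filter Set
open scoped Topology BigOperators
open Literature.MathematicalPhysics.KineticTheory.HeatConduction
open Summit.AtomisticToContinuum.FouriersLaw.Theses.CoercivePulse (LinearCeiling)
open Summit.AtomisticToContinuum.FouriersLaw.Theses.CageBudgetFekete (HeatVarianceCeiling HeatVarianceCalculus)

/-- **Abel mean under an affine bound (pure real analysis).** If `V(t) ≤ K + B·t` on `(0, ∞)`,
`e^{−νt}V` is integrable on `(0,∞)` and `A(ν) = (ν²/2)∫₀^∞ e^{−νt}V(t)dt` (`ν > 0`), then `A(ν) ≤ B/2 + (K/2)·ν`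
(`∫₀^∞e^{−νt}dt = 1/ν`, `∫₀^∞te^{−νt}dt = 1/ν²`). [cite: Widder1941, Ch. V §1] -/
theorem abelMean_le_of_affineBound {V : ℝ → ℝ} {K B ν A : ℝ} (hν : 0 < ν)
    (hV : ∀ t : ℝ, 0 < t → V t ≤ K + B * t)
    (hint : IntegrableOn (fun t => Real.exp (-(ν * t)) * V t) (Ioi 0))
    (hA : A = ν ^ 2 / 2 * ∫ t in Ioi (0:ℝ), Real.exp (-(ν * t)) * V t) :
    A ≤ B / 2 + K / 2 * ν := by
  have hE0 : IntegrableOn (fun t => Real.exp (-(ν * t))) (Ioi 0) ∧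
      ∫ t in Ioi (0:ℝ), Real.exp (-(ν * t)) = ν⁻¹ := by
    refine ⟨by simpa only [neg_mul] using exp_neg_integrableOn_Ioi 0 hν, ?_⟩
    rw [show (fun t : ℝ => Real.exp (-(ν * t))) = fun t => Real.exp (-ν * t) from
        funext fun t => by rw [neg_mul],
      integral_exp_mul_Ioi (neg_lt_zero.mpr hν) 0, mul_zero, Real.exp_zero, neg_div, one_div, inv_neg, neg_neg]
  have hE1 : IntegrableOn (fun t => Real.exp (-(ν * t)) * t) (Ioi 0) ∧
      ∫ t in Ioi (0:ℝ), Real.exp (-(ν * t)) * t = (ν ^ 2)⁻¹ := by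
    have h := Real.integral_rpow_mul_exp_neg_mul_Ioi (a := 2) (r := ν) (by norm_num) hν
    rw [Real.Gamma_two, mul_one, Real.rpow_two, one_div, inv_pow] at h
    have hv : ∫ t in Ioi (0:ℝ), Real.exp (-(ν * t)) * t = (ν ^ 2)⁻¹ :=
      (setIntegral_congr_fun measurableSet_Ioi fun t _ => by
        rw [show (2:ℝ) - 1 = 1 by norm_num, Real.rpow_one, mul_comm]).trans h
    exact ⟨Integrable.of_integral_ne_zero (by rw [hv]; positivity), hv⟩
  obtain ⟨hi0, hv0⟩ := hE0
  obtain ⟨hi1, hv1⟩ := hE1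
  have iU : IntegrableOn (fun t => Real.exp (-(ν * t)) * (K + B * t)) (Ioi 0) ∧
      ∫ t in Ioi (0:ℝ), Real.exp (-(ν * t)) * (K + B * t) = K * ν⁻¹ + B * (ν ^ 2)⁻¹ := by
    have e : (fun t : ℝ => Real.exp (-(ν * t)) * (K + B * t)) =
        fun t => K * Real.exp (-(ν * t)) + B * (Real.exp (-(ν * t)) * t) := funext fun t => by ring
    rw [e]
    exact ⟨(hi0.const_mul K).add (hi1.const_mul B), by
      rw [integral_add (hi0.const_mul K) (hi1.const_mul B), integral_const_mul, integral_const_mul, hv0, hv1]⟩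
  have cU := setIntegral_mono_on hint iU.1 measurableSet_Ioi
    fun t ht => mul_le_mul_of_nonneg_left (hV t ht) (Real.exp_pos (-(ν * t))).le
  rw [iU.2] at cU
  have f2 : ν ^ 2 / 2 * (K * ν⁻¹ + B * (ν ^ 2)⁻¹) = B / 2 + K / 2 * ν := by field_simp; ring
  rw [hA]
  exact f2 ▸ mul_le_mul_of_nonneg_left cU (by positivity)

/-- **`HeatVarianceCeiling` ⇒ (AC).** The eventual linear bound on the equilibrium heat variance
(`CageBudgetFekete.HeatVarianceCeiling`, stmt-15770) gives the infinite-volume Abel ceiling of `C_T` for every guarded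
pair: the guard's a.e. shift covariance is derivable, `HeatVarianceCalculus` (stmt-15772, proved) supplies absolute
convergence, continuity of `C_T` and the Laplace identity `∫₀^∞e^{−νt}C_T = (ν²/2)∫₀^∞e^{−νt}V_T`, the cosine-Bochner
representation bounds `|C_T| ≤ σ(ℝ)` hence `V_T(t) ≤ 2σ(ℝ)τ₊²` on `(0, τ₊]`, and `abelMean_le_of_affineBound` concludes.
[cite: Helfand1960, §II] [cite: BonettoLebowitzReyBellet2000, §7 eq. (37)] -/
theorem abelCeiling_of_heatVarianceCeiling (hHV : HeatVarianceCeiling) :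
    ∀ ω₂ lam β γ : ℝ, 0 < ω₂ → 0 < lam → 0 < β → ∀ T : ℝ, 0 < T →
      ∀ μ : MeasureTheory.Measure ChainConfig, (pinnedChain ω₂ lam β γ).IsChainGibbsMeasure T μ →
      IsShiftInvariant μ → μ.map (fun σ : ChainConfig => fun x : ℤ => ((σ x).1, -(σ x).2)) = μ →
      ∀ D : InfiniteChainDynamics (pinnedChain ω₂ lam β γ), D.PreservesMeasure μ →
      ∃ B ν₀ : ℝ, 0 < ν₀ ∧ ∀ ν : ℝ, 0 < ν → ν < ν₀ →
        ∫ t in Set.Ioi (0:ℝ), Real.exp (-(ν * t)) * D.currentCorrelation μ t ≤ B := by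
  intro ω₂ lam β γ hω hl hβ T hT μ hG hSI hR D hP
  have hSh : ∀ t : ℝ, ∀ᵐ σ ∂μ, D.flow t (shift σ) = shift (D.flow t σ) := fun t =>
    Summit.AtomisticToContinuum.FouriersLaw.Theorems.LinearCeiling.Negative.shiftCovariant_of_preservesMeasure
      hω hl hβ hT hG hSI D hP t
  -- the heat variance, generalised, and its calculus
  obtain ⟨V, hV⟩ : ∃ V : ℝ → ℝ, V = (fun τ : ℝ => 2 * ∫ s in Set.Ioc (0:ℝ) τ, (τ - s) * D.currentCorrelation μ s) :=
    ⟨_, rfl⟩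
  obtain ⟨hAC, hCc, hcalc⟩ :=
    Summit.AtomisticToContinuum.FouriersLaw.Theorems.HeatVarianceCalculus.CanonicalRigidity.heatVarianceCalculus_proof
      ω₂ lam β γ hω hl hβ T hT μ hG hSI hR D hP hSh
  obtain ⟨-, hLap⟩ := hcalc V hV
  obtain ⟨B, τ₁, hB⟩ := hHV ω₂ lam β γ hω hl hβ T hT μ hG hSI hR D hP hSh hAC hCc V hV
  -- `|C_T| ≤ σ(ℝ)` from the cosine-Bochner representation
  obtain ⟨σ, hσ, hC⟩ := stub_spectralRepresentation ω₂ lam β γ hω hl hβ T hT μ hG hSI hR D hP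
  haveI := hσ
  have hCb : ∀ u : ℝ, ‖D.currentCorrelation μ u‖ ≤ σ.real univ := fun u => by
    rw [hC u]
    exact norm_cosTransform_le σ u
  -- the affine bound `V t ≤ K + B⁺ t` on `(0, ∞)`
  set τp : ℝ := max τ₁ 0 with hτp
  have hτp0 : 0 ≤ τp := le_max_right _ _
  set K : ℝ := 2 * (τp * σ.real univ * τp) with hK
  have hK0 : 0 ≤ K := by positivity
  have hVb : ∀ t : ℝ, 0 < t → V t ≤ K + max B 0 * t := by
    intro t ht
    rcases le_or_gt t τp with h1 | h1
    · -- small times: `V t ≤ ‖V t‖ ≤ 2 t σ(ℝ) t ≤ K`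
      have hn := norm_setIntegral_sub_mul_le hCb ht.le
      have hVt : V t = 2 * ∫ u in Ioc (0:ℝ) t, (t - u) * D.currentCorrelation μ u := by rw [hV]
      have h2 : V t ≤ 2 * (t * σ.real univ * t) := by
        rw [hVt]
        have := (le_abs_self _).trans ((Real.norm_eq_abs _).symm.le.trans hn)
        linarith
      have h3 : t * σ.real univ * t ≤ τp * σ.real univ * τp := by
        have hs : 0 ≤ σ.real univ := measureReal_nonneg
        have := mul_le_mul h1 h1 ht.le hτp0
        nlinarith
      have h4 : 0 ≤ max B 0 * t := by positivity
      linarith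
    · -- large times: the eventual ceiling
      have h2 := hB t ((le_max_left _ _).trans h1.le)
      have h3 : B * t ≤ max B 0 * t := mul_le_mul_of_nonneg_right (le_max_left _ _) ht.le
      linarith
  refine ⟨max B 0 / 2 + K / 2, 1, one_pos, fun ν hν hν1 => ?_⟩
  obtain ⟨-, hIV, hId⟩ := hLap ν hν
  have hle := abelMean_le_of_affineBound hν hVb hIV hId
  have h2 : K / 2 * ν ≤ K / 2 := by
    have := mul_le_mul_of_nonneg_left hν1.le (div_nonneg hK0 zero_le_two)
    simpa only [mul_one] using this
  linarith

/-- **`HeatVarianceCeiling → LinearCeiling`** (close-on-close certificate, stmt-15770 ⇒ stmt-15383): through the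
infinite-volume Abel ceiling and `linearCeiling_of_abelCeiling`. [cite: Helfand1960, §II] -/
theorem linearCeiling_of_heatVarianceCeiling (hHV : HeatVarianceCeiling) : LinearCeiling :=
  linearCeiling_of_abelCeiling (abelCeiling_of_heatVarianceCeiling hHV)

/-- **`LinearCeiling → HeatVarianceCeiling`** (close-on-close certificate, stmt-15383 ⇒ stmt-15770): `LinearCeiling`
gives the Abel ceiling (`abelCeiling_of_linearCeiling`, via the proved `PulseCalculus`), and the cosine-Bochner kernel
comparison `stub_envelopeOfSpectralAbelBound` turns it into `V_T(τ) ≤ b·τ` for ALL `τ ≥ 0` (`τ₁ = 0`).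
[cite: Helfand1960, §II] -/
theorem heatVarianceCeiling_of_linearCeiling (hLC : LinearCeiling) : HeatVarianceCeiling := by
  intro ω₂ lam β γ hω hl hβ T hT μ hG hSI hR D hP _ _ _ V hV
  obtain ⟨B, ν₀, hν₀, hA⟩ := abelCeiling_of_linearCeiling hLC ω₂ lam β γ hω hl hβ T hT μ hG hSI hR D hP
  obtain ⟨σ, hσ, hC⟩ := stub_spectralRepresentation ω₂ lam β γ hω hl hβ T hT μ hG hSI hR D hP
  obtain ⟨b, hb⟩ := stub_envelopeOfSpectralAbelBound σ hσ _ hC B ν₀ hν₀ hA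
  refine ⟨b, 0, fun τ hτ => ?_⟩
  rw [hV]
  exact hb τ hτ

/-- **`LinearCeiling ↔ HeatVarianceCeiling`** — the cruxes stmt-AtomisticToContinuum-15383 (route `CoercivePulse`) and
stmt-AtomisticToContinuum-15770 (route `CageBudgetFekete`) are EQUIVALENT over landed theorems: both are the
infinite-volume Abel ceiling of the summed current autocorrelation (finiteness half of the conductivity of the infinite
pinned anharmonic chain, limsup/Abelian form). [cite: Helfand1960, §II] -/
theorem linearCeiling_iff_heatVarianceCeiling : LinearCeiling ↔ HeatVarianceCeiling :=
  ⟨heatVarianceCeiling_of_linearCeiling, linearCeiling_of_heatVarianceCeiling⟩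

end Summit.AtomisticToContinuum.FouriersLaw.Theorems.LinearCeiling.SpikeLemma

end
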